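import Summits.Ventures.HodgeRepro2.T5InertDegreeRelation

/-!
# The adjointness relation of the structure constants, and the structure constants from the degrees
(cell pub-hodge-repro2, seat p3)

Tier-5 N3 support. For a `K`-bi-invariant, inverse-closed double coset `K w K` the structure constants
`c^m_{w,n} = #{x K ⊆ K gₙ K : x⁻¹ g_m ∈ K w K}` (seat p8's T5-5x count) satisfy the ADJOINTNESS relation
`c^m_{w,n} · #(K g_m K / K) = c^n_{w,m} · #(K gₙ K / K)`: both sides count the pairs
`(x K, y K) ∈ K gₙ K / K × K g_m K / K` with `x⁻¹ y ∈ K w K`, the count being `K`-invariant in each variable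
and the relation symmetric. Applied to the cells of `U(antidiag(1, u, 1))` with `w = a₁` and the top
coefficient `1` of file 187, this gives `dₙ · deg Tₙ = deg T_{n+1}`, and with the degree relation of file
190 the structure constants of the three-term recurrence are determined by the degree sequence:

* `smul_mem_orbit_iff`, `out_inv_smul_smul_mem_iff`, **`ncard_inter_smul_eq`** — the count
  `#{x K ⊆ K gₙ K : x⁻¹ y ∈ K w K}` is `K`-invariant in `y`;
* `mk_mul_inv_mem_orbit_iff` — symmetry of the relation `x⁻¹ y ∈ K w K` for inverse-closed `K w K`;
* **`ncard_inter_mul_ncard_orbit_eq`** (abstract) — the adjointness relation, by double counting;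
* **`coeff_mul_ncard_eq`** — its form for the cells: `c^m_{j,n} · deg T_m = c^n_{j,m} · deg Tₙ` in `k`;
* **`adjoint_relation`** — `dₙ · deg Tₙ = deg T_{n+1}`;
* **`structure_constant_eq_of_degrees`** — `cₙ · deg T_{n+1} = deg T₁ · deg T_{n+1} − deg T_{n+2} − deg T_{n+1}`
  (file 190's degree relation with `dₙ deg Tₙ` replaced): THE STRUCTURE CONSTANTS OF `H(U(2,1), K)` ARE
  DETERMINED BY THE DEGREES `deg Tₙ = #(K aₙ K / K)`.

What stays prose: the degree sequence `deg Tₙ = (q³ + 1) q^{4n−3}` (`q = #(R/ϖ)`), which these relations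
turn into `cₙ = q − 1`, `dₙ = q⁴` and hence the Satake normalisation `T₁ ↔ q²(X + X⁻¹) + (q − 1)`.

Mathlib + this seat's files 187–190 + seat p8's T5-5x / T5-53 / T5-136 and their imports; no display;
no device. §8(d): uses an L-value-free non-vanishing device: NO.
-/

namespace Summit.Ventures.HodgeRepro2.T5InertAdjointRelation

open Summit.Ventures.HodgeRepro2.T5CartanCellsDistinct Summit.Ventures.HodgeRepro2.T5HeckeBasisCells
  Summit.Ventures.HodgeRepro2.T5HermitianThreeElements Summit.Ventures.HodgeRepro2.T5UnitaryGroupForm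
  Summit.Ventures.HodgeRepro2.T5UnitaryHeckeAdjoint Summit.Ventures.HodgeRepro2.T5HeckeDoubleCoset
  Summit.Ventures.HodgeRepro2.T5HeckeConvolution Summit.Ventures.HodgeRepro2.T5HeckePermutationModule
  Summit.Ventures.HodgeRepro2.T5InertTopCoefficient Summit.Ventures.HodgeRepro2.T5InertDegreeRelation

/-! ## Double counting for a `K`-bi-invariant relation -/

section Abstract

variable {G : Type*} [Group G] {K : Subgroup G}

/-- The `K`-orbits of `G ⧸ K` are `K`-stable. -/
theorem smul_mem_orbit_iff (κ : K) (z : G ⧸ K) (w : G) :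
    κ • z ∈ MulAction.orbit K (w : G ⧸ K) ↔ z ∈ MulAction.orbit K (w : G ⧸ K) := by
  rw [MulAction.mem_orbit_iff, MulAction.mem_orbit_iff]
  constructor
  · rintro ⟨κ', hκ'⟩
    exact ⟨κ⁻¹ * κ', by rw [mul_smul, hκ', inv_smul_smul]⟩
  · rintro ⟨κ', hκ'⟩
    exact ⟨κ * κ', by rw [mul_smul, hκ']⟩

/-- The action of `κ ∈ K` on `G ⧸ K` is left multiplication on representatives. -/
theorem smul_mk_eq (κ : K) (g : G) : κ • (g : G ⧸ K) = ((κ : G) * g : G ⧸ K) := rfl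

/-- The relation `(out x)⁻¹ • y ∈ K w K` is invariant under the simultaneous action of `κ ∈ K` on
`x` and `y`. -/
theorem out_inv_smul_smul_mem_iff (κ : K) (x y : G ⧸ K) (w : G) :
    ((Quotient.out (κ • x))⁻¹ • (κ • y) : G ⧸ K) ∈ MulAction.orbit K (w : G ⧸ K) ↔
      ((Quotient.out x)⁻¹ • y : G ⧸ K) ∈ MulAction.orbit K (w : G ⧸ K) := by
  have hx : κ • x = (((κ : G) * Quotient.out x : G) : G ⧸ K) := by
    conv_lhs => rw [← QuotientGroup.out_eq' x]
    rfl
  rw [hx]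
  obtain ⟨h, hh⟩ := QuotientGroup.mk_out_eq_mul K ((κ : G) * Quotient.out x)
  rw [hh]
  have hy : κ • y = (κ : G) • y := rfl
  rw [hy, mul_inv_rev, mul_inv_rev, mul_smul, mul_smul, inv_smul_smul]
  exact smul_mem_orbit_iff h⁻¹ _ w

/-- **The count is `K`-invariant**: `#{x ∈ K gₙ K / K : x⁻¹ (κ y) ∈ K w K} = #{x ∈ K gₙ K / K : x⁻¹ y ∈ K w K}`. -/
theorem ncard_inter_smul_eq (κ : K) (gn : G) (y : G ⧸ K) (w : G) :
    (MulAction.orbit K (gn : G ⧸ K) ∩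
        {x | ((Quotient.out x)⁻¹ • (κ • y) : G ⧸ K) ∈ MulAction.orbit K (w : G ⧸ K)}).ncard =
      (MulAction.orbit K (gn : G ⧸ K) ∩
        {x | ((Quotient.out x)⁻¹ • y : G ⧸ K) ∈ MulAction.orbit K (w : G ⧸ K)}).ncard := by
  refine Set.ncard_congr (fun x _ => κ⁻¹ • x) ?_ ?_ ?_
  · rintro x ⟨hx1, hx2⟩
    refine ⟨(smul_mem_orbit_iff κ⁻¹ x gn).2 hx1, ?_⟩
    have := (out_inv_smul_smul_mem_iff κ⁻¹ x (κ • y) w).2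
    rw [inv_smul_smul] at this
    exact this hx2
  · intro x x' _ _ hxx'
    exact smul_left_cancel κ⁻¹ hxx'
  · rintro x' ⟨hx1, hx2⟩
    refine ⟨κ • x', ⟨(smul_mem_orbit_iff κ x' gn).2 hx1, (out_inv_smul_smul_mem_iff κ x' y w).2 hx2⟩,
      inv_smul_smul κ x'⟩

/-- The count is constant on the orbit `K g_m K / K`. -/
theorem ncard_inter_eq_of_mem_orbit (gn gm : G) {y : G ⧸ K} (hy : y ∈ MulAction.orbit K (gm : G ⧸ K))
    (w : G) :
    (MulAction.orbit K (gn : G ⧸ K) ∩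
        {x | ((Quotient.out x)⁻¹ • y : G ⧸ K) ∈ MulAction.orbit K (w : G ⧸ K)}).ncard =
      (MulAction.orbit K (gn : G ⧸ K) ∩
        {x | ((Quotient.out x)⁻¹ • (gm : G ⧸ K) : G ⧸ K) ∈ MulAction.orbit K (w : G ⧸ K)}).ncard := by
  obtain ⟨κ, rfl⟩ := MulAction.mem_orbit_iff.1 hy
  exact ncard_inter_smul_eq κ gn _ w

/-- The relation on representatives: `(out x)⁻¹ • y ∈ K w K ↔ (out x)⁻¹ · out y ∈ K w K`. -/
theorem out_inv_smul_mem_iff (x y : G ⧸ K) (w : G) :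
    ((Quotient.out x)⁻¹ • y : G ⧸ K) ∈ MulAction.orbit K (w : G ⧸ K) ↔
      (((Quotient.out x)⁻¹ * Quotient.out y : G) : G ⧸ K) ∈ MulAction.orbit K (w : G ⧸ K) := by
  conv_lhs => rw [← QuotientGroup.out_eq' y]
  rw [MulAction.Quotient.smul_mk, smul_eq_mul]

/-- **Symmetry** of the relation `a⁻¹ b ∈ K w K` when `K w K` is inverse-closed. -/
theorem mk_mul_inv_mem_orbit_iff {w : G} (hinv : ((w⁻¹ : G) : G ⧸ K) ∈ MulAction.orbit K (w : G ⧸ K))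
    (a b : G) :
    (((a⁻¹ * b : G) : G ⧸ K) ∈ MulAction.orbit K (w : G ⧸ K)) ↔
      (((b⁻¹ * a : G) : G ⧸ K) ∈ MulAction.orbit K (w : G ⧸ K)) := by
  have h : (b⁻¹ * a : G) = (a⁻¹ * b)⁻¹ := by rw [mul_inv_rev, inv_inv]
  rw [h, T5HeckeTranspose.mem_orbit_inv_iff, MulAction.orbit_eq_iff.2 hinv]

/-- **The adjointness relation** (abstract double count): for an inverse-closed `K w K`,
`#{x ∈ K gₙ K / K : x⁻¹ g_m ∈ K w K} · #(K g_m K / K) = #{y ∈ K g_m K / K : y⁻¹ gₙ ∈ K w K} · #(K gₙ K / K)`. -/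
theorem ncard_inter_mul_ncard_orbit_eq (gn gm : G) {w : G}
    (hinv : ((w⁻¹ : G) : G ⧸ K) ∈ MulAction.orbit K (w : G ⧸ K))
    [Finite (MulAction.orbit K (gn : G ⧸ K))] [Finite (MulAction.orbit K (gm : G ⧸ K))] :
    (MulAction.orbit K (gn : G ⧸ K) ∩
        {x | ((Quotient.out x)⁻¹ • (gm : G ⧸ K) : G ⧸ K) ∈ MulAction.orbit K (w : G ⧸ K)}).ncard *
      (MulAction.orbit K (gm : G ⧸ K)).ncard =
    (MulAction.orbit K (gm : G ⧸ K) ∩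
        {y | ((Quotient.out y)⁻¹ • (gn : G ⧸ K) : G ⧸ K) ∈ MulAction.orbit K (w : G ⧸ K)}).ncard *
      (MulAction.orbit K (gn : G ⧸ K)).ncard := by
  classical
  set On := MulAction.orbit K (gn : G ⧸ K) with hOn
  set Om := MulAction.orbit K (gm : G ⧸ K) with hOm
  have hOnf : On.Finite := Set.toFinite _
  have hOmf : Om.Finite := Set.toFinite _
  -- the relation, symmetric for inverse-closed `K w K`
  set r : G ⧸ K → G ⧸ K → Prop := fun x y =>
    ((Quotient.out x)⁻¹ • y : G ⧸ K) ∈ MulAction.orbit K (w : G ⧸ K) with hr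
  have hsymm : ∀ x y, r x y ↔ r y x := fun x y => by
    simp only [hr]
    rw [out_inv_smul_mem_iff, out_inv_smul_mem_iff, mk_mul_inv_mem_orbit_iff hinv]
  -- the counts as cards of filters
  have hcount : ∀ (O : Set (G ⧸ K)) (hO : O.Finite) (p : G ⧸ K → Prop),
      (O ∩ {x | p x}).ncard = (hO.toFinset.filter p).card := by
    intro O hO p
    rw [Set.ncard_eq_toFinset_card _ (hO.inter_of_left _)]
    congr 1
    ext x
    simp only [Set.Finite.mem_toFinset, Set.mem_inter_iff, Set.mem_setOf_eq, Finset.mem_filter]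
  -- the double count: Σ_{y ∈ Om} #{x ∈ On : r x y} = Σ_{x ∈ On} #{y ∈ Om : r x y}
  have hdouble : ∑ y ∈ hOmf.toFinset, (hOnf.toFinset.filter fun x => r x y).card =
      ∑ x ∈ hOnf.toFinset, (hOmf.toFinset.filter fun y => r x y).card := by
    simp only [Finset.card_filter]
    exact Finset.sum_comm
  -- each inner count is constant on the orbit
  have hconst_y : ∀ y ∈ hOmf.toFinset, (hOnf.toFinset.filter fun x => r x y).card =
      (hOnf.toFinset.filter fun x => r x (gm : G ⧸ K)).card := by
    intro y hy
    rw [← hcount On hOnf, ← hcount On hOnf]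
    exact ncard_inter_eq_of_mem_orbit gn gm (hOmf.mem_toFinset.1 hy) w
  have hconst_x : ∀ x ∈ hOnf.toFinset, (hOmf.toFinset.filter fun y => r x y).card =
      (hOmf.toFinset.filter fun y => r y (gn : G ⧸ K)).card := by
    intro x hx
    have h1 : (hOmf.toFinset.filter fun y => r x y) = hOmf.toFinset.filter fun y => r y x :=
      Finset.filter_congr fun y _ => hsymm x y
    rw [h1, ← hcount Om hOmf, ← hcount Om hOmf]
    exact ncard_inter_eq_of_mem_orbit gm gn (hOnf.mem_toFinset.1 hx) w
  rw [Finset.sum_const_nat hconst_y, Finset.sum_const_nat hconst_x] at hdouble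
  rw [hcount On hOnf, hcount Om hOmf, Set.ncard_eq_toFinset_card _ hOmf,
    Set.ncard_eq_toFinset_card _ hOnf, mul_comm, hdouble, mul_comm]

end Abstract

/-! ## The cells: `c^m_{j,n} · deg T_m = c^n_{j,m} · deg Tₙ` -/

section Cells

variable {R E : Type*} [CommRing R] [Field E] [StarRing E] [Algebra R E] [IsFractionRing R E] [IsDomain R]
  [IsDiscreteValuationRing R] [Finite (IsLocalRing.ResidueField R)]
  (u : E) {ϖ : R} (hϖ : Irreducible ϖ) (hs : star (algebraMap R E ϖ) = algebraMap R E ϖ)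
  (k : Type*) [Field k]

/-- **The adjointness relation for the cells**: `c^m_{j,n} · deg T_m = c^n_{j,m} · deg Tₙ` in `k`, where
`c^m_{j,n} = ((T_j Tₙ) δ_K)(a_m K)` (p8's T5-5x count) and `deg T_m = #(K a_m K / K)`. -/
theorem coeff_mul_ncard_eq (j n m : ℕ) :
    (((doubleCosetOp k (hyperspecialSubgroup R (J3 u)) (cellU hϖ hs u j) *
        doubleCosetOp k (hyperspecialSubgroup R (J3 u)) (cellU hϖ hs u n) :
        heckeAlgebra k (hyperspecialSubgroup R (J3 u))) :
        Module.End k (MonoidAlgebra k (formUnitaryGroup (J3 u) ⧸ hyperspecialSubgroup R (J3 u))))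
      (MonoidAlgebra.single ((1 : formUnitaryGroup (J3 u)) :
        formUnitaryGroup (J3 u) ⧸ hyperspecialSubgroup R (J3 u)) 1)).coeff
      ((cellU hϖ hs u m : formUnitaryGroup (J3 u)) :
        formUnitaryGroup (J3 u) ⧸ hyperspecialSubgroup R (J3 u)) *
      ((MulAction.orbit (hyperspecialSubgroup R (J3 u))
        ((cellU hϖ hs u m : formUnitaryGroup (J3 u)) :
          formUnitaryGroup (J3 u) ⧸ hyperspecialSubgroup R (J3 u))).ncard : k) =
    (((doubleCosetOp k (hyperspecialSubgroup R (J3 u)) (cellU hϖ hs u j) *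
        doubleCosetOp k (hyperspecialSubgroup R (J3 u)) (cellU hϖ hs u m) :
        heckeAlgebra k (hyperspecialSubgroup R (J3 u))) :
        Module.End k (MonoidAlgebra k (formUnitaryGroup (J3 u) ⧸ hyperspecialSubgroup R (J3 u))))
      (MonoidAlgebra.single ((1 : formUnitaryGroup (J3 u)) :
        formUnitaryGroup (J3 u) ⧸ hyperspecialSubgroup R (J3 u)) 1)).coeff
      ((cellU hϖ hs u n : formUnitaryGroup (J3 u)) :
        formUnitaryGroup (J3 u) ⧸ hyperspecialSubgroup R (J3 u)) *
      ((MulAction.orbit (hyperspecialSubgroup R (J3 u))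
        ((cellU hϖ hs u n : formUnitaryGroup (J3 u)) :
          formUnitaryGroup (J3 u) ⧸ hyperspecialSubgroup R (J3 u))).ncard : k) := by
  rw [coeff_doubleCosetOp_mul_apply_single_one, coeff_doubleCosetOp_mul_apply_single_one, ← Nat.cast_mul,
    ← Nat.cast_mul]
  exact congrArg _ (ncard_inter_mul_ncard_orbit_eq (cellU hϖ hs u n) (cellU hϖ hs u m)
    (inv_cellU_mem_orbit u hϖ hs j))

end Cells

/-! ## `dₙ · deg Tₙ = deg T_{n+1}` and the structure constants from the degrees -/

section Degrees

variable {R E : Type*} [CommRing R] [Field E] [StarRing E] [Algebra R E] [IsFractionRing R E] [IsDomain R]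
  [IsDiscreteValuationRing R] [Finite (IsLocalRing.ResidueField R)]
  (hstar : ∀ x : E, IsLocalization.IsInteger R x → IsLocalization.IsInteger R (star x))
  (u : E) (hsu : star u = u) (hu0 : u ≠ 0) (hu : IsLocalization.IsInteger R u)
  (hu' : IsLocalization.IsInteger R u⁻¹) {ϖ : R} (hϖ : Irreducible ϖ)
  (hs : star (algebraMap R E ϖ) = algebraMap R E ϖ) (k : Type*) [Field k]

include hstar hu0 hu hu' in
/-- **`dₙ · deg Tₙ = deg T_{n+1}`**: the structure constant `dₙ = ((T₁ T_{n+1}) δ_K)(aₙ K)` of file 189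
times the degree of `Tₙ` is the degree of `T_{n+1}` (the adjointness relation with `j = 1`, `m = n + 1`
and the top coefficient `1` of file 187). -/
theorem adjoint_relation (n : ℕ) :
    (((doubleCosetOp k (hyperspecialSubgroup R (J3 u)) (cellU hϖ hs u 1) *
        doubleCosetOp k (hyperspecialSubgroup R (J3 u)) (cellU hϖ hs u (n + 1)) :
        heckeAlgebra k (hyperspecialSubgroup R (J3 u))) :
        Module.End k (MonoidAlgebra k (formUnitaryGroup (J3 u) ⧸ hyperspecialSubgroup R (J3 u))))
      (MonoidAlgebra.single ((1 : formUnitaryGroup (J3 u)) :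
        formUnitaryGroup (J3 u) ⧸ hyperspecialSubgroup R (J3 u)) 1)).coeff
      ((cellU hϖ hs u n : formUnitaryGroup (J3 u)) :
        formUnitaryGroup (J3 u) ⧸ hyperspecialSubgroup R (J3 u)) *
      ((MulAction.orbit (hyperspecialSubgroup R (J3 u))
        ((cellU hϖ hs u n : formUnitaryGroup (J3 u)) :
          formUnitaryGroup (J3 u) ⧸ hyperspecialSubgroup R (J3 u))).ncard : k) =
    ((MulAction.orbit (hyperspecialSubgroup R (J3 u))
      ((cellU hϖ hs u (n + 1) : formUnitaryGroup (J3 u)) :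
        formUnitaryGroup (J3 u) ⧸ hyperspecialSubgroup R (J3 u))).ncard : k) := by
  have h := coeff_mul_ncard_eq u hϖ hs k 1 n (n + 1)
  rw [top_coeff_eq_one hstar u hu0 hu hu' hϖ hs k n, one_mul] at h
  exact h.symm

include hstar hsu hu0 hu hu' in
/-- **The structure constants from the degrees**: `cₙ · deg T_{n+1} = deg T₁ · deg T_{n+1} − deg T_{n+2} − deg T_{n+1}`
in `k` (file 190's degree relation with `dₙ · deg Tₙ = deg T_{n+1}` substituted). Together with
`adjoint_relation`, the structure constants of `H(U(J₃(u)), K)` are determined by the degree sequence. -/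
theorem structure_constant_eq_of_degrees (n : ℕ) :
    (((doubleCosetOp k (hyperspecialSubgroup R (J3 u)) (cellU hϖ hs u 1) *
        doubleCosetOp k (hyperspecialSubgroup R (J3 u)) (cellU hϖ hs u (n + 1)) :
        heckeAlgebra k (hyperspecialSubgroup R (J3 u))) :
        Module.End k (MonoidAlgebra k (formUnitaryGroup (J3 u) ⧸ hyperspecialSubgroup R (J3 u))))
      (MonoidAlgebra.single ((1 : formUnitaryGroup (J3 u)) :
        formUnitaryGroup (J3 u) ⧸ hyperspecialSubgroup R (J3 u)) 1)).coeff
      ((cellU hϖ hs u (n + 1) : formUnitaryGroup (J3 u)) :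
        formUnitaryGroup (J3 u) ⧸ hyperspecialSubgroup R (J3 u)) *
      ((MulAction.orbit (hyperspecialSubgroup R (J3 u))
        ((cellU hϖ hs u (n + 1) : formUnitaryGroup (J3 u)) :
          formUnitaryGroup (J3 u) ⧸ hyperspecialSubgroup R (J3 u))).ncard : k) =
    ((MulAction.orbit (hyperspecialSubgroup R (J3 u))
        ((cellU hϖ hs u 1 : formUnitaryGroup (J3 u)) :
          formUnitaryGroup (J3 u) ⧸ hyperspecialSubgroup R (J3 u))).ncard : k) *
      ((MulAction.orbit (hyperspecialSubgroup R (J3 u))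
        ((cellU hϖ hs u (n + 1) : formUnitaryGroup (J3 u)) :
          formUnitaryGroup (J3 u) ⧸ hyperspecialSubgroup R (J3 u))).ncard : k) -
      ((MulAction.orbit (hyperspecialSubgroup R (J3 u))
        ((cellU hϖ hs u (n + 1 + 1) : formUnitaryGroup (J3 u)) :
          formUnitaryGroup (J3 u) ⧸ hyperspecialSubgroup R (J3 u))).ncard : k) -
      ((MulAction.orbit (hyperspecialSubgroup R (J3 u))
        ((cellU hϖ hs u (n + 1) : formUnitaryGroup (J3 u)) :
          formUnitaryGroup (J3 u) ⧸ hyperspecialSubgroup R (J3 u))).ncard : k) := by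
  have h1 := degree_relation hstar u hsu hu0 hu hu' hϖ hs k n
  have h2 := adjoint_relation hstar u hu0 hu hu' hϖ hs k n
  linear_combination -h1 - h2

end Degrees

end Summit.Ventures.HodgeRepro2.T5InertAdjointRelation
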